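import Literature.Analysis.FunctionSpaces.TorusFourierModes
import Literature.Analysis.FunctionSpaces.TorusFluidGlueProofs
import HarnessLib

/-!
# The Fourier–Galerkin vector field of the Navier–Stokes equations on `T^d`

Trunk: FluidKinetic. The `N`-th Galerkin approximation of the (forced) Navier–Stokes system on
the flat torus is the ODE, in the finitely many Fourier coefficients `c_k ∈ ℂ^d`, `k ∈ S`
(`S ⊆ ℤ^d` a finite symmetric frequency set, `S = freqBall N` in the applications),
`ċ_k = -ν 4π²|k|² c_k + Π_k (ĝ_k - 𝓕[(u·∇)u](k))`, `u = realTrigPoly S c`, where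
`Π_k = I - k ⊗ k / |k|²` is the Fourier multiplier of the Leray projector
(Robinson–Rodrigo–Sadowski 2016, §4.1, (4.2)–(4.5); Constantin–Foias 1988, Ch. 8, (8.3)–(8.6);
Temam 1977, Ch. I, Rem. 1.6 and Ch. III, §3.2; Hopf 1951, §2). This file supplies the algebra
of that vector field and the dictionary between its Fourier-side terms and the space integrals
of `Torus.IsHopfGalerkinScheme` (`NSHopfGalerkin`): the tested Galerkin identity and the energy
identity are reduced to finite-sum identities, proved here once and for all.
(Fourier coefficients of finite character sums, of the Laplacian, and Parseval against
band-limited fields are imported from `TorusFourierModes`.)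

## Contents (all proved)

* `Torus.freqVec k` — the frequency `k ∈ ℤ^d` as a vector of `ℂ^d`;
  `Torus.leraySym k w = w - ((k·w)/|k|²) k` — the Leray multiplier **keeping the mean mode**
  (`leraySym 0 = id`, since `x / 0 = 0`), versus `Torus.lerayCoeff` of `LerayProjector`
  (mean-zero space `H`, `lerayCoeff 0 = 0`; the two agree for `k ≠ 0`, not imported here to keep
  the function-space layer light). Proved: transversality `∑ kᵢ (Π_k w)ᵢ = 0`, `Π_k w = w` on
  transversal `w`, self-adjointness against transversal vectors, evenness in `k`, commutation
  with conjugation, linearity, `‖Π_k w‖ ≤ ‖w‖`.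
* `Torus.convectionCoeff S c c' k = ∑_{l,m ∈ S, l+m=k} 2πi (c_l · m) c'_m` — the Fourier
  coefficients of the convective term of two vector trigonometric polynomials:
  **`𝓕[(u·∇)v](k) = convectionCoeff S c c' k`** for `u = realTrigPoly S c`,
  `v = realTrigPoly S c'` with conjugate-symmetric coefficients
  (`mFourierCoeff_convect_realTrigPoly`; the quadratic term of the Galerkin ODE, RRS 2016, (4.5),
  p. 74 / CF 1988, (8.5)); bilinearity,
  conjugate symmetry, and a crude norm bound.
* `Torus.galerkinField ν S g c k = -ν4π²|k|² c_k + Π_k (g_k - convectionCoeff S c c k)` — the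
  Galerkin vector field, with its two **master identities** for conjugate-symmetric transversal
  `c` and conjugate-symmetric `g` (`u = realTrigPoly S c`, `G = realTrigPoly S g`):
  - `sum_re_inner_galerkinField_test`: for every smooth divergence-free `a` band-limited to `S`,
    `∑_{k∈S} Re⟪V(c)_k, â_k⟫ = ∫ (⟪u, (u·∇)a⟫ + ν ⟪u, Δa⟫ + ⟪G, a⟫)` — the right-hand side of
    the tested Galerkin equations of `IsHopfGalerkinScheme.galerkin` (RRS (4.5) paired with `a`,
    antisymmetry of the trilinear form, Temam Ch. II, Lemma 1.3);
  - `sum_re_inner_galerkinField_self`: `∑_{k∈S} Re⟪c_k, V(c)_k⟫ = -ν ‖∇u‖² + ∫ ⟪G, u⟫` — the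
    energy identity `IsHopfGalerkinScheme.energy_eq` in differential form (RRS (4.6)–(4.7);
    CF (8.7); `⟪(u·∇)u, u⟫ = 0`).
  Also: `V(c)` is conjugate symmetric and transversal (the flow preserves real, divergence-free
  fields).
* `NS.galerkinSubspace S` — the real subspace of `S → ℂ^d` of conjugate-symmetric, transversal
  coefficient vectors (the Fourier coordinates of the Galerkin space), and
  `NS.galerkinRHS S ν g c` — the Galerkin field restricted to `S → ℂ^d`; invariance of the
  subspace under the field (`NS.galerkinRHS_mem`). The ODE itself (global solutions, tested and
  energy identities) is `NSGalerkinODE`.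

## Mathlib search

Mathlib (this pin) has the characters `UnitAddTorus.mFourier` with `mFourier_add`,
`mFourier_neg`, and `mFourierCoeff`; no Leray multiplier, no Galerkin system, no convolution
formula for Fourier coefficients of products on `UnitAddTorus` (searched `Galerkin`, `Leray`,
`mFourierCoeff_mul`: none). The tree's `Torus.lerayCoeff` (FluidPDE layer, kills `k = 0`) is the
mean-zero variant, documented above.

## References

* J. C. Robinson, J. L. Rodrigo, W. Sadowski, *The three-dimensional Navier–Stokes equations*,
  CUP 2016, §1.5 (1.10) (p. 27), Def. 2.1 (p. 42), Lemma 2.9 (p. 45), Lemma 3.2, §4.1 (4.1) (p. 71),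
  Thm. 4.4 Step 1, (4.3)–(4.7) (pp. 73–75).
* P. Constantin, C. Foias, *Navier–Stokes Equations*, Chicago 1988, Ch. 4 (periodic case),
  Ch. 8 (8.3)–(8.9).
* R. Temam, *Navier–Stokes Equations*, North-Holland 1977, Ch. I Rem. 1.6, Ch. II Lemma 1.3,
  Ch. III §3.2.
* E. Hopf, Math. Nachr. 4 (1951), 213–231, §2.
-/

open MeasureTheory Set Filter Topology UnitAddTorus
open scoped ENNReal NNReal InnerProductSpace ContDiff ComplexConjugate

noncomputable section

namespace Literature.Analysis.FluidPDE

namespace Torus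

variable {d : Type*} [Fintype d]

/-! ## The frequency vector and the Leray multiplier -/

section Leray

/-- The frequency `k ∈ ℤ^d` viewed as a vector of `ℂ^d`. [folklore] -/
def freqVec (k : d → ℤ) : EuclideanSpace ℂ d :=
  WithLp.toLp 2 fun i => (k i : ℂ)

omit [Fintype d] in
/-- Coordinates of the frequency vector. [folklore] -/
@[simp]
theorem freqVec_apply (k : d → ℤ) (i : d) : freqVec k i = (k i : ℂ) := rfl

omit [Fintype d] in
/-- The frequency vector is odd in `k`. [folklore] -/
theorem freqVec_neg (k : d → ℤ) : freqVec (-k) = -freqVec k := by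
  ext i; simp

omit [Fintype d] in
/-- The zero frequency gives the zero vector. [folklore] -/
theorem freqVec_zero : freqVec (0 : d → ℤ) = 0 := by
  ext i; simp

omit [Fintype d] in
/-- The frequency vector is real. [folklore] -/
theorem conjVec_freqVec (k : d → ℤ) : FunctionSpaces.EuclideanSpace.conjVec (freqVec k) = freqVec k := by
  ext i; simp [FunctionSpaces.EuclideanSpace.conjVec_apply]

/-- `∑ᵢ kᵢ kᵢ = |k|²` in `ℂ`. [folklore] -/
theorem sum_mul_freqVec (k : d → ℤ) :
    ∑ i, (k i : ℂ) * freqVec k i = ((FunctionSpaces.Torus.freqNormSq k : ℝ) : ℂ) := by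
  simp only [freqVec_apply, FunctionSpaces.Torus.freqNormSq]
  push_cast
  exact Finset.sum_congr rfl fun i _ => (sq _).symm

/-- `|k|² = 0` only for `k = 0`. [folklore] -/
theorem freqNormSq_eq_zero_iff (k : d → ℤ) : FunctionSpaces.Torus.freqNormSq k = 0 ↔ k = 0 := by
  constructor
  · intro h
    have h' := (Finset.sum_eq_zero_iff_of_nonneg fun i _ => sq_nonneg ((k i : ℝ))).1 h
    funext i
    have := h' i (Finset.mem_univ i)
    show k i = 0
    exact_mod_cast pow_eq_zero_iff (n := 2) two_ne_zero |>.1 this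
  · rintro rfl
    exact FunctionSpaces.Torus.freqNormSq_zero

/-- **The Leray multiplier keeping the mean mode**: `Π_k w = w - ((k · w)/|k|²) k`, with the
bilinear pairing `k · w = ∑ᵢ kᵢ wᵢ`; for `k = 0` this is the identity (`x / 0 = 0`), for
`k ≠ 0` the orthogonal projection of `ℂ^d` onto `k^⊥ = {w | k · w = 0}` — the Fourier symbol of
the Leray projector on `L²(T^d; ℝ^d)` when constants are retained (Constantin–Foias 1988, Ch. 4,
periodic case; Temam 1977, Ch. I, Rem. 1.6; RRS 2016, §2.1, Def. 2.1 and Lemma 2.9). For `k ≠ 0`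
it coincides with
`Torus.lerayCoeff k` of `Literature/Analysis/FluidPDE/LerayProjector` (which sends `k = 0` to
`0`, mean-zero convention). [cite: ConstantinFoias1988, Ch. 4 periodic case] -/
def leraySym (k : d → ℤ) (w : EuclideanSpace ℂ d) : EuclideanSpace ℂ d :=
  w - ((∑ i, (k i : ℂ) * w i) / ((FunctionSpaces.Torus.freqNormSq k : ℝ) : ℂ)) • freqVec k

/-- Unfolding of `leraySym`. [folklore] -/
theorem leraySym_def (k : d → ℤ) (w : EuclideanSpace ℂ d) :
    leraySym k w = w - ((∑ i, (k i : ℂ) * w i) / ((FunctionSpaces.Torus.freqNormSq k : ℝ) : ℂ)) • freqVec k := rfl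

/-- At the zero frequency the multiplier is the identity (the mean mode is kept). [folklore] -/
@[simp]
theorem leraySym_zero_freq (w : EuclideanSpace ℂ d) : leraySym 0 w = w := by
  simp [leraySym, freqVec_zero]

/-- On transversal vectors (`k · w = 0`) the multiplier is the identity. [folklore] -/
theorem leraySym_of_transversal {k : d → ℤ} {w : EuclideanSpace ℂ d}
    (h : ∑ i, (k i : ℂ) * w i = 0) : leraySym k w = w := by
  simp [leraySym, h]

/-- The Leray multiplier of the zero vector. [folklore] -/
@[simp]
theorem leraySym_zero (k : d → ℤ) : leraySym k (0 : EuclideanSpace ℂ d) = 0 := by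
  simp [leraySym]

/-- The Leray multiplier is additive. [folklore] -/
theorem leraySym_add (k : d → ℤ) (v w : EuclideanSpace ℂ d) :
    leraySym k (v + w) = leraySym k v + leraySym k w := by
  simp only [leraySym, PiLp.add_apply, mul_add, Finset.sum_add_distrib, add_div, add_smul]
  abel

/-- The Leray multiplier is `ℂ`-homogeneous. [folklore] -/
theorem leraySym_smul (k : d → ℤ) (a : ℂ) (w : EuclideanSpace ℂ d) :
    leraySym k (a • w) = a • leraySym k w := by
  simp only [leraySym, PiLp.smul_apply, smul_eq_mul, smul_sub, smul_smul]
  congr 2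
  rw [mul_div_assoc', Finset.mul_sum]
  congr 1
  refine Finset.sum_congr rfl fun i _ => ?_
  ring

/-- The Leray multiplier is `ℝ`-homogeneous. [folklore] -/
theorem leraySym_real_smul (k : d → ℤ) (a : ℝ) (w : EuclideanSpace ℂ d) :
    leraySym k (a • w) = a • leraySym k w := by
  rw [RCLike.real_smul_eq_coe_smul (K := ℂ), leraySym_smul, ← RCLike.real_smul_eq_coe_smul]

/-- The Leray multiplier commutes with negation. [folklore] -/
theorem leraySym_neg (k : d → ℤ) (w : EuclideanSpace ℂ d) : leraySym k (-w) = -leraySym k w := by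
  rw [← neg_one_smul ℂ w, leraySym_smul, neg_one_smul]

/-- The Leray multiplier respects differences. [folklore] -/
theorem leraySym_sub (k : d → ℤ) (v w : EuclideanSpace ℂ d) :
    leraySym k (v - w) = leraySym k v - leraySym k w := by
  rw [sub_eq_add_neg, leraySym_add, leraySym_neg, ← sub_eq_add_neg]

/-- The Leray multiplier as a `ℂ`-linear map. [folklore] -/
def leraySymₗ (k : d → ℤ) : EuclideanSpace ℂ d →ₗ[ℂ] EuclideanSpace ℂ d where
  toFun := leraySym k
  map_add' := leraySym_add k
  map_smul' := leraySym_smul k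

/-- The bundled Leray multiplier acts as `leraySym`. [folklore] -/
@[simp]
theorem leraySymₗ_apply (k : d → ℤ) (w : EuclideanSpace ℂ d) : leraySymₗ k w = leraySym k w := rfl

/-- **Transversality of the Leray multiplier**: `∑ᵢ kᵢ (Π_k w)ᵢ = 0`. [cite: ConstantinFoias1988, Ch. 4 periodic case] -/
theorem sum_mul_leraySym_apply (k : d → ℤ) (w : EuclideanSpace ℂ d) :
    ∑ i, (k i : ℂ) * leraySym k w i = 0 := by
  by_cases hk : k = 0
  · subst hk; simp
  have hq : ((FunctionSpaces.Torus.freqNormSq k : ℝ) : ℂ) ≠ 0 := by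
    rw [Ne, Complex.ofReal_eq_zero, freqNormSq_eq_zero_iff]
    exact hk
  simp only [leraySym, PiLp.sub_apply, PiLp.smul_apply, smul_eq_mul, mul_sub,
    Finset.sum_sub_distrib]
  have h2 : ∑ i, (k i : ℂ) * ((∑ j, (k j : ℂ) * w j) / ((FunctionSpaces.Torus.freqNormSq k : ℝ) : ℂ) * freqVec k i) =
      (∑ j, (k j : ℂ) * w j) / ((FunctionSpaces.Torus.freqNormSq k : ℝ) : ℂ) * ∑ i, (k i : ℂ) * freqVec k i := by
    rw [Finset.mul_sum]
    refine Finset.sum_congr rfl fun i _ => ?_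
    ring
  rw [h2, sum_mul_freqVec, div_mul_cancel₀ _ hq, sub_self]

/-- The multiplier is even in the frequency: `Π_{-k} = Π_k`. [folklore] -/
theorem leraySym_neg_freq (k : d → ℤ) (w : EuclideanSpace ℂ d) :
    leraySym (-k) w = leraySym k w := by
  simp only [leraySym, FunctionSpaces.Torus.freqNormSq_neg, freqVec_neg, Pi.neg_apply, Int.cast_neg, neg_mul,
    Finset.sum_neg_distrib, neg_div, smul_neg, neg_smul, neg_neg]

/-- The multiplier commutes with complex conjugation (it has real entries). [folklore] -/
theorem conjVec_leraySym (k : d → ℤ) (w : EuclideanSpace ℂ d) :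
    FunctionSpaces.EuclideanSpace.conjVec (leraySym k w) = leraySym k (FunctionSpaces.EuclideanSpace.conjVec w) := by
  rw [leraySym, leraySym, FunctionSpaces.EuclideanSpace.conjVec_sub, FunctionSpaces.EuclideanSpace.conjVec_smul, conjVec_freqVec]
  congr 2
  rw [map_div₀, Complex.conj_ofReal, map_sum]
  congr 1
  refine Finset.sum_congr rfl fun i _ => ?_
  rw [map_mul, map_intCast, FunctionSpaces.EuclideanSpace.conjVec_apply]

/-- `⟪k, v⟫_ℂ = ∑ᵢ kᵢ vᵢ` (the frequency vector is real). [folklore] -/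
theorem inner_freqVec_left (k : d → ℤ) (v : EuclideanSpace ℂ d) :
    inner ℂ (freqVec k) v = ∑ i, (k i : ℂ) * v i := by
  simp [PiLp.inner_apply, freqVec_apply, mul_comm]

/-- `⟪v, k⟫_ℂ = conj (∑ᵢ kᵢ vᵢ)`. [folklore] -/
theorem inner_freqVec_right (k : d → ℤ) (v : EuclideanSpace ℂ d) :
    inner ℂ v (freqVec k) = conj (∑ i, (k i : ℂ) * v i) := by
  rw [← inner_conj_symm, inner_freqVec_left]

/-- **Self-adjointness against transversal vectors** (left): if `k · v = 0` then
`⟪Π_k w, v⟫ = ⟪w, v⟫`. [cite: ConstantinFoias1988, Ch. 4 periodic case] -/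
theorem inner_leraySym_left_of_transversal (k : d → ℤ) (w : EuclideanSpace ℂ d)
    {v : EuclideanSpace ℂ d} (hv : ∑ i, (k i : ℂ) * v i = 0) :
    inner ℂ (leraySym k w) v = inner ℂ w v := by
  rw [leraySym, inner_sub_left, inner_smul_left, inner_freqVec_left, hv, mul_zero, sub_zero]

/-- **Self-adjointness against transversal vectors** (right): if `k · v = 0` then
`⟪v, Π_k w⟫ = ⟪v, w⟫`. [cite: ConstantinFoias1988, Ch. 4 periodic case] -/
theorem inner_leraySym_right_of_transversal (k : d → ℤ) (w : EuclideanSpace ℂ d)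
    {v : EuclideanSpace ℂ d} (hv : ∑ i, (k i : ℂ) * v i = 0) :
    inner ℂ v (leraySym k w) = inner ℂ v w := by
  rw [leraySym, inner_sub_right, inner_smul_right, inner_freqVec_right, hv, map_zero, mul_zero,
    sub_zero]

/-- **The Leray multiplier is a contraction**: `‖Π_k w‖ ≤ ‖w‖` (`w = Π_k w + λ k` with
`Π_k w ⊥ k`). [cite: ConstantinFoias1988, Ch. 4 periodic case] -/
theorem norm_leraySym_le (k : d → ℤ) (w : EuclideanSpace ℂ d) : ‖leraySym k w‖ ≤ ‖w‖ := by
  set lam : ℂ := (∑ i, (k i : ℂ) * w i) / ((FunctionSpaces.Torus.freqNormSq k : ℝ) : ℂ) with hlam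
  have hdec : w = leraySym k w + lam • freqVec k := by
    rw [leraySym, hlam, sub_add_cancel]
  have horth : inner ℂ (leraySym k w) (lam • freqVec k) = 0 := by
    rw [inner_smul_right, inner_freqVec_right, sum_mul_leraySym_apply, map_zero, mul_zero]
  have hsq : ‖w‖ ^ 2 = ‖leraySym k w‖ ^ 2 + ‖lam • freqVec k‖ ^ 2 := by
    conv_lhs => rw [hdec]
    rw [@norm_add_sq ℂ, horth, map_zero, mul_zero, add_zero]
  have hle : ‖leraySym k w‖ ^ 2 ≤ ‖w‖ ^ 2 := by
    rw [hsq]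
    exact le_add_of_nonneg_right (sq_nonneg _)
  exact (pow_le_pow_iff_left₀ (norm_nonneg _) (norm_nonneg _) two_ne_zero).1 hle

/-- The Leray multiplier is `1`-Lipschitz. [folklore] -/
theorem norm_leraySym_sub_le (k : d → ℤ) (v w : EuclideanSpace ℂ d) :
    ‖leraySym k v - leraySym k w‖ ≤ ‖v - w‖ := by
  rw [← leraySym_sub]
  exact norm_leraySym_le k _

/-- The Leray multiplier is continuous (a linear map of a finite-dimensional space). [folklore] -/
theorem continuous_leraySym (k : d → ℤ) : Continuous (leraySym (d := d) k) :=
  (leraySymₗ k).continuous_of_finiteDimensional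

end Leray

/-! ## The convection symbol -/

section Convection

/-- **The convection symbol**: for coefficient families `c, c'` on a finite frequency set `S`,
`convectionCoeff S c c' k = ∑_{l ∈ S} ∑_{m ∈ S, l + m = k} (2πi ∑ⱼ (c l)ⱼ mⱼ) • c' m` — the
`k`-th Fourier coefficient of the convective derivative `(u·∇)v` of the vector trigonometric
polynomials `u = ∑_l e_l c_l`, `v = ∑_m e_m c'_m` (since `(u·∇)(e_m c'_m) = (u · 2πi m) e_m c'_m`
and `e_l e_m = e_{l+m}`; this is the quadratic term `∑ B_{ijk} c_i c_j` / `∑ b(w_k, w_l, w_j) ξ_k ξ_l`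
of the Galerkin system, Robinson–Rodrigo–Sadowski 2016, (4.5), p. 74; Constantin–Foias 1988, (8.5);
Temam 1977, Ch. III, §3.2). [cite: ConstantinFoias1988, Ch. 8 (8.5)] -/
def convectionCoeff (S : Finset (d → ℤ)) (c c' : (d → ℤ) → EuclideanSpace ℂ d) (k : d → ℤ) :
    EuclideanSpace ℂ d :=
  ∑ l ∈ S, ∑ m ∈ S,
    if l + m = k then (2 * Real.pi * Complex.I * ∑ j, c l j * (m j : ℂ)) • c' m else 0

/-- Unfolding of `convectionCoeff`. [folklore] -/
theorem convectionCoeff_def (S : Finset (d → ℤ)) (c c' : (d → ℤ) → EuclideanSpace ℂ d)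
    (k : d → ℤ) :
    convectionCoeff S c c' k = ∑ l ∈ S, ∑ m ∈ S,
      if l + m = k then (2 * Real.pi * Complex.I * ∑ j, c l j * (m j : ℂ)) • c' m else 0 := rfl

/-- The convection symbol vanishes for a zero first argument. [folklore] -/
@[simp]
theorem convectionCoeff_zero_left (S : Finset (d → ℤ)) (c' : (d → ℤ) → EuclideanSpace ℂ d) :
    convectionCoeff S 0 c' = 0 := by
  funext k
  simp [convectionCoeff]

/-- The convection symbol vanishes for a zero second argument. [folklore] -/
@[simp]
theorem convectionCoeff_zero_right (S : Finset (d → ℤ)) (c : (d → ℤ) → EuclideanSpace ℂ d) :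
    convectionCoeff S c 0 = 0 := by
  funext k
  simp [convectionCoeff]

/-- The convection symbol is additive in the first argument. [folklore] -/
theorem convectionCoeff_add_left (S : Finset (d → ℤ)) (c₁ c₂ c' : (d → ℤ) → EuclideanSpace ℂ d)
    (k : d → ℤ) :
    convectionCoeff S (c₁ + c₂) c' k = convectionCoeff S c₁ c' k + convectionCoeff S c₂ c' k := by
  simp only [convectionCoeff, ← Finset.sum_add_distrib]
  refine Finset.sum_congr rfl fun l _ => Finset.sum_congr rfl fun m _ => ?_
  split_ifs
  · simp only [Pi.add_apply, PiLp.add_apply, add_mul, Finset.sum_add_distrib, mul_add, add_smul]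
  · simp

/-- The convection symbol is additive in the second argument. [folklore] -/
theorem convectionCoeff_add_right (S : Finset (d → ℤ)) (c c₁ c₂ : (d → ℤ) → EuclideanSpace ℂ d)
    (k : d → ℤ) :
    convectionCoeff S c (c₁ + c₂) k = convectionCoeff S c c₁ k + convectionCoeff S c c₂ k := by
  simp only [convectionCoeff, ← Finset.sum_add_distrib]
  refine Finset.sum_congr rfl fun l _ => Finset.sum_congr rfl fun m _ => ?_
  split_ifs
  · simp only [Pi.add_apply, smul_add]
  · simp

/-- The convection symbol is homogeneous in the first argument. [folklore] -/
theorem convectionCoeff_smul_left (S : Finset (d → ℤ)) (a : ℂ)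
    (c c' : (d → ℤ) → EuclideanSpace ℂ d) (k : d → ℤ) :
    convectionCoeff S (a • c) c' k = a • convectionCoeff S c c' k := by
  simp only [convectionCoeff, Finset.smul_sum]
  refine Finset.sum_congr rfl fun l _ => Finset.sum_congr rfl fun m _ => ?_
  split_ifs
  · simp only [Pi.smul_apply, PiLp.smul_apply, smul_eq_mul, smul_smul]
    congr 1
    simp only [Finset.mul_sum]
    exact Finset.sum_congr rfl fun j _ => by ring
  · simp

/-- The convection symbol is homogeneous in the second argument. [folklore] -/
theorem convectionCoeff_smul_right (S : Finset (d → ℤ)) (a : ℂ)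
    (c c' : (d → ℤ) → EuclideanSpace ℂ d) (k : d → ℤ) :
    convectionCoeff S c (a • c') k = a • convectionCoeff S c c' k := by
  simp only [convectionCoeff, Finset.smul_sum]
  refine Finset.sum_congr rfl fun l _ => Finset.sum_congr rfl fun m _ => ?_
  split_ifs
  · rw [Pi.smul_apply, smul_comm]
  · simp

/-- The convection symbol respects differences in the first argument. [folklore] -/
theorem convectionCoeff_sub_left (S : Finset (d → ℤ)) (c₁ c₂ c' : (d → ℤ) → EuclideanSpace ℂ d)
    (k : d → ℤ) :
    convectionCoeff S (c₁ - c₂) c' k = convectionCoeff S c₁ c' k - convectionCoeff S c₂ c' k := by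
  have h : c₁ - c₂ = c₁ + (-1 : ℂ) • c₂ := by rw [neg_one_smul, sub_eq_add_neg]
  rw [h, convectionCoeff_add_left, convectionCoeff_smul_left, neg_one_smul, sub_eq_add_neg]

/-- The convection symbol respects differences in the second argument. [folklore] -/
theorem convectionCoeff_sub_right (S : Finset (d → ℤ)) (c c₁ c₂ : (d → ℤ) → EuclideanSpace ℂ d)
    (k : d → ℤ) :
    convectionCoeff S c (c₁ - c₂) k = convectionCoeff S c c₁ k - convectionCoeff S c c₂ k := by
  have h : c₁ - c₂ = c₁ + (-1 : ℂ) • c₂ := by rw [neg_one_smul, sub_eq_add_neg]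
  rw [h, convectionCoeff_add_right, convectionCoeff_smul_right, neg_one_smul, sub_eq_add_neg]

/-- The "difference of squares" for the quadratic convection symbol:
`B(c,c) - B(c',c') = B(c - c', c) + B(c', c - c')`. [folklore] -/
theorem convectionCoeff_self_sub_self (S : Finset (d → ℤ)) (c c' : (d → ℤ) → EuclideanSpace ℂ d)
    (k : d → ℤ) :
    convectionCoeff S c c k - convectionCoeff S c' c' k =
      convectionCoeff S (c - c') c k + convectionCoeff S c' (c - c') k := by
  rw [convectionCoeff_sub_left, convectionCoeff_sub_right]
  abel

/-- **Crude bound for the convection symbol**: if `‖c l‖ ≤ R` and `‖c' m‖ ≤ R'` on `S` then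
`‖convectionCoeff S c c' k‖ ≤ 2π (#S ∑_{m∈S} ∑ⱼ |mⱼ|) R R'`. [folklore] -/
theorem norm_convectionCoeff_le (S : Finset (d → ℤ)) {c c' : (d → ℤ) → EuclideanSpace ℂ d}
    {R R' : ℝ} (hc : ∀ l ∈ S, ‖c l‖ ≤ R) (hc' : ∀ m ∈ S, ‖c' m‖ ≤ R') (k : d → ℤ) :
    ‖convectionCoeff S c c' k‖ ≤
      2 * Real.pi * (S.card * ∑ m ∈ S, ∑ j, |(m j : ℝ)|) * R * R' := by
  -- termwise bound
  have hterm : ∀ l ∈ S, ∀ m ∈ S,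
      ‖(if l + m = k then (2 * Real.pi * Complex.I * ∑ j, c l j * (m j : ℂ)) • c' m else 0)‖ ≤
        2 * Real.pi * (∑ j, |(m j : ℝ)|) * R * R' := by
    intro l hl m hm
    have hR : 0 ≤ R := (norm_nonneg _).trans (hc l hl)
    have hR' : 0 ≤ R' := (norm_nonneg _).trans (hc' m hm)
    have hsum : ‖∑ j, c l j * (m j : ℂ)‖ ≤ (∑ j, |(m j : ℝ)|) * R := by
      refine (norm_sum_le _ _).trans ?_
      rw [Finset.sum_mul]
      refine Finset.sum_le_sum fun j _ => ?_
      rw [norm_mul, Complex.norm_intCast, mul_comm]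
      refine mul_le_mul_of_nonneg_left ?_ (abs_nonneg _)
      exact (PiLp.norm_apply_le (c l) j).trans (hc l hl)
    have hcoef : ‖2 * (Real.pi : ℂ) * Complex.I * ∑ j, c l j * (m j : ℂ)‖ =
        2 * Real.pi * ‖∑ j, c l j * (m j : ℂ)‖ := by
      rw [show (2 : ℂ) * (Real.pi : ℂ) * Complex.I * ∑ j, c l j * (m j : ℂ) =
        ((2 * Real.pi : ℝ) : ℂ) * (Complex.I * ∑ j, c l j * (m j : ℂ)) by push_cast; ring]
      rw [norm_mul, Complex.norm_real, Real.norm_of_nonneg (by positivity), norm_mul,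
        Complex.norm_I, one_mul]
    split_ifs
    · rw [norm_smul, hcoef]
      calc 2 * Real.pi * ‖∑ j, c l j * (m j : ℂ)‖ * ‖c' m‖
          ≤ 2 * Real.pi * ((∑ j, |(m j : ℝ)|) * R) * R' :=
            mul_le_mul (by gcongr) (hc' m hm) (norm_nonneg _) (by positivity)
        _ = _ := by ring
    · rw [norm_zero]; positivity
  calc ‖convectionCoeff S c c' k‖
      ≤ ∑ l ∈ S, ‖∑ m ∈ S, (if l + m = k then
          (2 * Real.pi * Complex.I * ∑ j, c l j * (m j : ℂ)) • c' m else 0)‖ := norm_sum_le _ _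
    _ ≤ ∑ l ∈ S, ∑ m ∈ S, ‖(if l + m = k then
          (2 * Real.pi * Complex.I * ∑ j, c l j * (m j : ℂ)) • c' m else 0)‖ :=
        Finset.sum_le_sum fun _ _ => norm_sum_le _ _
    _ ≤ ∑ l ∈ S, ∑ m ∈ S, 2 * Real.pi * (∑ j, |(m j : ℝ)|) * R * R' :=
        Finset.sum_le_sum fun l hl => Finset.sum_le_sum fun m hm => hterm l hl m hm
    _ = 2 * Real.pi * (S.card * ∑ m ∈ S, ∑ j, |(m j : ℝ)|) * R * R' := by
        rw [Finset.sum_const, nsmul_eq_mul]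
        simp only [Finset.mul_sum, Finset.sum_mul]
        exact Finset.sum_congr rfl fun m _ => Finset.sum_congr rfl fun j _ => by ring

/-- **Conjugate symmetry of the convection symbol**: for conjugate-symmetric `c, c'` on a
symmetric `S`, `convectionCoeff S c c' (-k) = conj (convectionCoeff S c c' k)` (the convective
term of real fields is real). [folklore] -/
theorem _root_.Literature.Analysis.FunctionSpaces.Torus.IsConjSymm.convectionCoeff {S : Finset (d → ℤ)} (hS : ∀ k ∈ S, -k ∈ S)
    {c c' : (d → ℤ) → EuclideanSpace ℂ d} (hc : FunctionSpaces.Torus.IsConjSymm c) (hc' : FunctionSpaces.Torus.IsConjSymm c') :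
    FunctionSpaces.Torus.IsConjSymm (Torus.convectionCoeff S c c') := by
  intro k
  rw [Torus.convectionCoeff_def, Torus.convectionCoeff_def, FunctionSpaces.EuclideanSpace.conjVec_sum]
  -- reindex `l ↦ -l`, then `m ↦ -m`
  refine Finset.sum_nbij' (fun l => -l) (fun l => -l) (fun l hl => hS l hl) (fun l hl => hS l hl)
    (fun l _ => neg_neg l) (fun l _ => neg_neg l) fun l _ => ?_
  rw [FunctionSpaces.EuclideanSpace.conjVec_sum]
  refine Finset.sum_nbij' (fun m => -m) (fun m => -m) (fun m hm => hS m hm) (fun m hm => hS m hm)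
    (fun m _ => neg_neg m) (fun m _ => neg_neg m) fun m _ => ?_
  have hiff : (-l + -m = k) ↔ (l + m = -k) := by
    constructor
    · intro h
      rw [← h]
      abel
    · intro h
      have hk : k = -(l + m) := by rw [h, neg_neg]
      rw [hk]
      abel
  by_cases h : l + m = -k
  · rw [if_pos h, if_pos (hiff.2 h), FunctionSpaces.EuclideanSpace.conjVec_smul, hc l, hc' m,
      FunctionSpaces.EuclideanSpace.conjVec_conjVec]
    congr 1
    simp only [map_neg, map_mul, map_sum, Complex.conj_I, map_ofNat, Complex.conj_ofReal,
      map_intCast, Pi.neg_apply, Int.cast_neg, FunctionSpaces.EuclideanSpace.conjVec_apply, Complex.conj_conj,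
      mul_neg, Finset.sum_neg_distrib]
    ring
  · rw [if_neg h, if_neg (fun h' => h (hiff.1 h')), FunctionSpaces.EuclideanSpace.conjVec_zero]

end Convection

/-! ## Fourier coefficients of the convective term and of the Laplacian -/

section Analytic

variable [DecidableEq d]

omit [DecidableEq d] in
/-- Real coordinates of a real trigonometric polynomial with conjugate-symmetric coefficients,
as complex numbers: `((realTrigPoly S c x) i : ℂ) = ∑_{l∈S} e_l(x) (c l) i`. [folklore] -/
theorem coe_realTrigPoly_apply_coord {S : Finset (d → ℤ)} (hS : ∀ k ∈ S, -k ∈ S)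
    {c : (d → ℤ) → EuclideanSpace ℂ d} (hc : FunctionSpaces.Torus.IsConjSymm c) (x : UnitAddTorus d) (i : d) :
    ((FunctionSpaces.Torus.realTrigPoly S c x i : ℝ) : ℂ) = ∑ l ∈ S, mFourier l x * c l i := by
  rw [show ((FunctionSpaces.Torus.realTrigPoly S c x i : ℝ) : ℂ) = FunctionSpaces.EuclideanSpace.complexify (FunctionSpaces.Torus.realTrigPoly S c x) i
    from rfl, FunctionSpaces.Torus.complexify_realTrigPoly hS hc x, FunctionSpaces.Torus.trigPoly_apply_coord]

/-- **The convective term of two vector trigonometric polynomials, pointwise**: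
`complexify ((u·∇)v)(x) = ∑_{l,m∈S} e_{l+m}(x) (2πi ∑ⱼ (c l)ⱼ mⱼ) • c' m` for
`u = realTrigPoly S c`, `v = realTrigPoly S c'` with conjugate-symmetric coefficients
(the quadratic term of the Galerkin system: RRS 2016, (4.5), p. 74; CF 1988, (8.5)). [cite: ConstantinFoias1988, Ch. 8 (8.5)] -/
theorem complexify_convect_realTrigPoly {S : Finset (d → ℤ)} (hS : ∀ k ∈ S, -k ∈ S)
    {c c' : (d → ℤ) → EuclideanSpace ℂ d} (hc : FunctionSpaces.Torus.IsConjSymm c) (hc' : FunctionSpaces.Torus.IsConjSymm c')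
    (x : UnitAddTorus d) :
    FunctionSpaces.EuclideanSpace.complexify (FunctionSpaces.Torus.convect (FunctionSpaces.Torus.realTrigPoly S c) (FunctionSpaces.Torus.realTrigPoly S c') x) =
      ∑ l ∈ S, ∑ m ∈ S,
        (mFourier (l + m) x * (2 * Real.pi * Complex.I * ∑ j, c l j * (m j : ℂ))) • c' m := by
  have hv : FunctionSpaces.Torus.IsContDiff 1 (FunctionSpaces.Torus.realTrigPoly S c') := (FunctionSpaces.Torus.isSmooth_realTrigPoly S c').isContDiff (by simp)
  -- each term `uᵢ ∂ᵢ v` on the Fourier side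
  have hterm : ∀ i : d, FunctionSpaces.EuclideanSpace.complexify
      ((FunctionSpaces.Torus.realTrigPoly S c x) i • FunctionSpaces.Torus.partialDeriv i (FunctionSpaces.Torus.realTrigPoly S c') x) =
      ∑ m ∈ S, ∑ l ∈ S, (mFourier l x * c l i * mFourier m x *
        (2 * Real.pi * Complex.I * (m i : ℂ))) • c' m := by
    intro i
    rw [LinearIsometry.map_smul, ← FunctionSpaces.Torus.partialDeriv_complexify_comp (FunctionSpaces.Torus.isSmooth_realTrigPoly S c'),
      FunctionSpaces.Torus.complexify_comp_realTrigPoly hS hc', FunctionSpaces.Torus.partialDeriv_trigPoly, FunctionSpaces.Torus.trigPoly_apply,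
      ← Complex.coe_smul, coe_realTrigPoly_apply_coord hS hc, Finset.smul_sum]
    refine Finset.sum_congr rfl fun m _ => ?_
    rw [Finset.sum_smul]
    refine Finset.sum_congr rfl fun l _ => ?_
    rw [smul_smul, smul_smul]
  rw [FunctionSpaces.Torus.convect, FunctionSpaces.Torus.fderiv_apply_eq_sum_partialDeriv hv, map_sum]
  simp_rw [hterm]
  -- now `∑ i, ∑ m, ∑ l (e_l c_{l,i} e_m 2πi mᵢ) • c'_m = ∑ l, ∑ m, (e_{l+m} 2πi (c_l·m)) • c'_m`
  conv_rhs => rw [Finset.sum_comm]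
  rw [Finset.sum_comm]
  refine Finset.sum_congr rfl fun m _ => ?_
  rw [Finset.sum_comm]
  refine Finset.sum_congr rfl fun l _ => ?_
  rw [← Finset.sum_smul]
  congr 1
  simp only [mFourier_add, Finset.mul_sum]
  refine Finset.sum_congr rfl fun j _ => ?_
  ring

/-- **Fourier coefficients of the convective term of vector trigonometric polynomials**:
`𝓕[complexify ∘ (u·∇)v](k) = convectionCoeff S c c' k` for `u = realTrigPoly S c`,
`v = realTrigPoly S c'` with conjugate-symmetric coefficients on a symmetric `S`
(the quadratic term of the Galerkin system: RRS 2016, (4.5), p. 74; CF 1988, (8.5)). [cite: ConstantinFoias1988, Ch. 8 (8.5)] -/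
theorem mFourierCoeff_convect_realTrigPoly {S : Finset (d → ℤ)} (hS : ∀ k ∈ S, -k ∈ S)
    {c c' : (d → ℤ) → EuclideanSpace ℂ d} (hc : FunctionSpaces.Torus.IsConjSymm c) (hc' : FunctionSpaces.Torus.IsConjSymm c')
    (k : d → ℤ) :
    mFourierCoeff (FunctionSpaces.EuclideanSpace.complexify ∘ FunctionSpaces.Torus.convect (FunctionSpaces.Torus.realTrigPoly S c) (FunctionSpaces.Torus.realTrigPoly S c')) k =
      convectionCoeff S c c' k := by
  have hfun : (FunctionSpaces.EuclideanSpace.complexify ∘ FunctionSpaces.Torus.convect (FunctionSpaces.Torus.realTrigPoly S c) (FunctionSpaces.Torus.realTrigPoly S c')) =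
      fun x => ∑ p ∈ S ×ˢ S, mFourier (p.1 + p.2) x •
        ((2 * Real.pi * Complex.I * ∑ j, c p.1 j * (p.2 j : ℂ)) • c' p.2) := by
    funext x
    rw [Function.comp_apply, complexify_convect_realTrigPoly hS hc hc', Finset.sum_product]
    simp_rw [smul_smul]
  rw [hfun, FunctionSpaces.Torus.mFourierCoeff_sum_mFourier_smul, Finset.sum_product]
  rfl

end Analytic

/-! ## The Galerkin vector field and its two master identities -/

section Field

variable [DecidableEq d]

/-- **The Fourier–Galerkin vector field** of the Navier–Stokes equations with viscosity `ν` on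
the frequency set `S`, driven by force coefficients `g`:
`galerkinField ν S g c k = -ν 4π²|k|² c k + Π_k (g k - convectionCoeff S c c k)` — the
right-hand side of the Galerkin ODE `ċ = V(c)` for the coefficients of
`u = realTrigPoly S c` (Robinson–Rodrigo–Sadowski 2016, (4.5) in Fourier variables;
Constantin–Foias 1988, (8.5)–(8.6); Temam 1977, Ch. III, (3.43)). [cite: RobinsonRodrigoSadowski2016, Thm. 4.4 Step 1 (4.5)] -/
def galerkinField (ν : ℝ) (S : Finset (d → ℤ)) (g c : (d → ℤ) → EuclideanSpace ℂ d)
    (k : d → ℤ) : EuclideanSpace ℂ d :=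
  -(((ν * (4 * Real.pi ^ 2 * FunctionSpaces.Torus.freqNormSq k) : ℝ) : ℂ) • c k) +
    leraySym k (g k - convectionCoeff S c c k)

omit [DecidableEq d] in
/-- Unfolding of `galerkinField`. [folklore] -/
theorem galerkinField_def (ν : ℝ) (S : Finset (d → ℤ)) (g c : (d → ℤ) → EuclideanSpace ℂ d)
    (k : d → ℤ) :
    galerkinField ν S g c k = -(((ν * (4 * Real.pi ^ 2 * FunctionSpaces.Torus.freqNormSq k) : ℝ) : ℂ) • c k) +
      leraySym k (g k - convectionCoeff S c c k) := rfl

omit [DecidableEq d] in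
/-- **The Galerkin field is transversal**: `∑ᵢ kᵢ V(c)_k,i = 0` whenever `c k` is transversal
(the Stokes term is a scalar multiple of `c k`, the rest is Leray-projected). [folklore] -/
theorem sum_mul_galerkinField_apply (ν : ℝ) (S : Finset (d → ℤ))
    (g c : (d → ℤ) → EuclideanSpace ℂ d) {k : d → ℤ} (hck : ∑ i, (k i : ℂ) * c k i = 0) :
    ∑ i, (k i : ℂ) * galerkinField ν S g c k i = 0 := by
  have h1 : ∑ i, (k i : ℂ) * ((((ν * (4 * Real.pi ^ 2 * FunctionSpaces.Torus.freqNormSq k) : ℝ) : ℂ) • c k) i) =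
      (((ν * (4 * Real.pi ^ 2 * FunctionSpaces.Torus.freqNormSq k) : ℝ) : ℂ)) * ∑ i, (k i : ℂ) * c k i := by
    rw [Finset.mul_sum]
    refine Finset.sum_congr rfl fun i _ => ?_
    rw [PiLp.smul_apply, smul_eq_mul]
    ring
  simp only [galerkinField, PiLp.add_apply, PiLp.neg_apply, mul_add, mul_neg,
    Finset.sum_add_distrib, Finset.sum_neg_distrib, sum_mul_leraySym_apply, h1, hck, mul_zero,
    neg_zero, add_zero]

omit [DecidableEq d] in
/-- The Galerkin field preserves transversality on `S`. [folklore] -/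
theorem isTransversal_galerkinField (ν : ℝ) {S : Finset (d → ℤ)}
    (g : (d → ℤ) → EuclideanSpace ℂ d) {c : (d → ℤ) → EuclideanSpace ℂ d}
    (hc : FunctionSpaces.Torus.IsTransversal S c) : FunctionSpaces.Torus.IsTransversal S (galerkinField ν S g c) :=
  fun k hk => sum_mul_galerkinField_apply ν S g c (hc k hk)

omit [DecidableEq d] in
/-- **The Galerkin field is conjugate symmetric** for conjugate-symmetric `c`, `g` on a
symmetric `S` (the Galerkin flow preserves real fields). [folklore] -/
theorem _root_.Literature.Analysis.FunctionSpaces.Torus.IsConjSymm.galerkinField (ν : ℝ) {S : Finset (d → ℤ)} (hS : ∀ k ∈ S, -k ∈ S)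
    {g c : (d → ℤ) → EuclideanSpace ℂ d} (hg : FunctionSpaces.Torus.IsConjSymm g) (hc : FunctionSpaces.Torus.IsConjSymm c) :
    FunctionSpaces.Torus.IsConjSymm (Torus.galerkinField ν S g c) := by
  intro k
  have hcc := (hc.convectionCoeff hS hc) k
  rw [Torus.galerkinField_def, Torus.galerkinField_def, FunctionSpaces.EuclideanSpace.conjVec_add,
    FunctionSpaces.EuclideanSpace.conjVec_neg, FunctionSpaces.EuclideanSpace.conjVec_smul, Complex.conj_ofReal, FunctionSpaces.Torus.freqNormSq_neg,
    hc k, leraySym_neg_freq, hg k, hcc, ← FunctionSpaces.EuclideanSpace.conjVec_sub, conjVec_leraySym]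

omit [DecidableEq d] in
/-- The Stokes multiplier against a coefficient: `Re⟪-(ν4π²|k|²) c k, w⟫ = Re⟪c k, -(ν4π²|k|²) w⟫`
(real scalar). [folklore] -/
theorem re_inner_real_smul_left (a : ℝ) (v w : EuclideanSpace ℂ d) :
    (inner ℂ (((a : ℝ) : ℂ) • v) w).re = (inner ℂ v (((a : ℝ) : ℂ) • w)).re := by
  rw [inner_smul_left, inner_smul_right, Complex.conj_ofReal]

variable {S : Finset (d → ℤ)}

/-- **Master identity I (tested Galerkin equations).** Let `S` be symmetric, `c` conjugate
symmetric and transversal on `S`, `g` conjugate symmetric, `u = realTrigPoly S c`,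
`G = realTrigPoly S g`, and let `a` be a smooth divergence-free field band-limited to `S`
(`â = 0` off `S`). Then
`∑_{k∈S} Re⟪galerkinField ν S g c k, â k⟫ = ∫ (⟪u, (u·∇)a⟫ + ν ⟪u, Δa⟫ + ⟪G, a⟫)`:
the Stokes term by `𝓕(Δa) = -4π²|k|² â` and Parseval, the force by `Π_k â_k = â_k`
(transversality of `â`) and Parseval, the nonlinearity by
`∑_{k∈S} Re⟪𝓕[(u·∇)u](k), â(k)⟫ = ∫ ⟪(u·∇)u, a⟫ = -∫ ⟪u, (u·∇)a⟫` (Parseval against the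
band-limited `a`, antisymmetry of the trilinear form for `div u = 0`; RRS 2016, (4.5) and
Lemma 3.2; Temam 1977, Ch. II Lemma 1.3, Ch. III (3.43)). [cite: RobinsonRodrigoSadowski2016, Thm. 4.4 Step 1 (4.5)] -/
theorem sum_re_inner_galerkinField_test (ν : ℝ) (hS : ∀ k ∈ S, -k ∈ S)
    {g c : (d → ℤ) → EuclideanSpace ℂ d} (hg : FunctionSpaces.Torus.IsConjSymm g) (hc : FunctionSpaces.Torus.IsConjSymm c)
    (hcT : FunctionSpaces.Torus.IsTransversal S c) {a : UnitAddTorus d → EuclideanSpace ℝ d} (ha : FunctionSpaces.Torus.IsSmooth a)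
    (hdiv : FunctionSpaces.Torus.IsDivFree a)
    (hband : ∀ k ∉ S, mFourierCoeff (FunctionSpaces.EuclideanSpace.complexify ∘ a) k = 0) :
    ∑ k ∈ S, (inner ℂ (galerkinField ν S g c k)
        (mFourierCoeff (FunctionSpaces.EuclideanSpace.complexify ∘ a) k)).re =
      ∫ x, (⟪FunctionSpaces.Torus.realTrigPoly S c x, FunctionSpaces.Torus.convect (FunctionSpaces.Torus.realTrigPoly S c) a x⟫_ℝ +
        ν * ⟪FunctionSpaces.Torus.realTrigPoly S c x, FunctionSpaces.Torus.laplacian a x⟫_ℝ + ⟪FunctionSpaces.Torus.realTrigPoly S g x, a x⟫_ℝ) := by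
  have hu : FunctionSpaces.Torus.IsSmooth (FunctionSpaces.Torus.realTrigPoly S c) := FunctionSpaces.Torus.isSmooth_realTrigPoly S c
  have hudiv : FunctionSpaces.Torus.IsDivFree (FunctionSpaces.Torus.realTrigPoly S c) := FunctionSpaces.Torus.isDivFree_realTrigPoly hcT
  have hâT : ∀ k, ∑ i, (k i : ℂ) * mFourierCoeff (FunctionSpaces.EuclideanSpace.complexify ∘ a) k i = 0 :=
    fun k => hdiv.sum_mul_mFourierCoeff_eq_zero ha k
  -- split the field
  have hsplit : ∀ k ∈ S, (inner ℂ (galerkinField ν S g c k)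
      (mFourierCoeff (FunctionSpaces.EuclideanSpace.complexify ∘ a) k)).re =
      ν * (inner ℂ (c k) (-(((4 * Real.pi ^ 2 * FunctionSpaces.Torus.freqNormSq k : ℝ) : ℂ) •
        mFourierCoeff (FunctionSpaces.EuclideanSpace.complexify ∘ a) k))).re +
        ((inner ℂ (g k) (mFourierCoeff (FunctionSpaces.EuclideanSpace.complexify ∘ a) k)).re -
          (inner ℂ (convectionCoeff S c c k) (mFourierCoeff (FunctionSpaces.EuclideanSpace.complexify ∘ a) k)).re) := by
    intro k _
    rw [galerkinField, inner_add_left, Complex.add_re, inner_leraySym_left_of_transversal _ _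
      (hâT k), inner_sub_left, Complex.sub_re, inner_neg_left, Complex.neg_re,
      re_inner_real_smul_left, inner_neg_right, Complex.neg_re]
    congr 1
    rw [Complex.ofReal_mul, mul_smul, inner_smul_right, Complex.re_ofReal_mul]
    ring
  rw [Finset.sum_congr rfl hsplit, Finset.sum_add_distrib, Finset.sum_sub_distrib,
    ← Finset.mul_sum]
  -- Stokes term
  have hlap : ∑ k ∈ S, (inner ℂ (c k) (-(((4 * Real.pi ^ 2 * FunctionSpaces.Torus.freqNormSq k : ℝ) : ℂ) •
      mFourierCoeff (FunctionSpaces.EuclideanSpace.complexify ∘ a) k))).re =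
      ∫ x, ⟪FunctionSpaces.Torus.realTrigPoly S c x, FunctionSpaces.Torus.laplacian a x⟫_ℝ := by
    rw [FunctionSpaces.Torus.integral_inner_realTrigPoly_left hS hc (ha.laplacian.memLp 2)]
    refine Finset.sum_congr rfl fun k _ => ?_
    rw [FunctionSpaces.Torus.mFourierCoeff_complexify_laplacian ha]
  -- force term
  have hforce : ∑ k ∈ S, (inner ℂ (g k) (mFourierCoeff (FunctionSpaces.EuclideanSpace.complexify ∘ a) k)).re =
      ∫ x, ⟪FunctionSpaces.Torus.realTrigPoly S g x, a x⟫_ℝ := by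
    rw [FunctionSpaces.Torus.integral_inner_realTrigPoly_left hS hg (ha.memLp 2)]
  -- nonlinear term
  have hnl : ∑ k ∈ S, (inner ℂ (convectionCoeff S c c k)
      (mFourierCoeff (FunctionSpaces.EuclideanSpace.complexify ∘ a) k)).re =
      -∫ x, ⟪FunctionSpaces.Torus.realTrigPoly S c x, FunctionSpaces.Torus.convect (FunctionSpaces.Torus.realTrigPoly S c) a x⟫_ℝ := by
    have h1 := FunctionSpaces.Torus.integral_inner_eq_sum_of_band_limited ((hu.convect hu).memLp 2) (ha.memLp 2) hband
    simp_rw [mFourierCoeff_convect_realTrigPoly hS hc hc] at h1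
    rw [← h1, FunctionSpaces.Torus.integral_inner_convect_eq_neg hu hudiv hu ha]
  rw [hlap, hforce, hnl]
  -- assemble the integral of the sum
  have hi1 : Integrable (fun x => ⟪FunctionSpaces.Torus.realTrigPoly S c x, FunctionSpaces.Torus.convect (FunctionSpaces.Torus.realTrigPoly S c) a x⟫_ℝ) volume :=
    (hu.inner (hu.convect ha)).integrable
  have hi2 : Integrable (fun x => ν * ⟪FunctionSpaces.Torus.realTrigPoly S c x, FunctionSpaces.Torus.laplacian a x⟫_ℝ) volume :=
    ((hu.inner ha.laplacian).integrable).const_mul ν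
  have hi3 : Integrable (fun x => ⟪FunctionSpaces.Torus.realTrigPoly S g x, a x⟫_ℝ) volume :=
    ((FunctionSpaces.Torus.isSmooth_realTrigPoly S g).inner ha).integrable
  have hi12 : Integrable (fun x => ⟪FunctionSpaces.Torus.realTrigPoly S c x, FunctionSpaces.Torus.convect (FunctionSpaces.Torus.realTrigPoly S c) a x⟫_ℝ +
      ν * ⟪FunctionSpaces.Torus.realTrigPoly S c x, FunctionSpaces.Torus.laplacian a x⟫_ℝ) volume := hi1.add hi2
  rw [integral_add hi12 hi3, integral_add hi1 hi2, integral_const_mul]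
  ring

/-- **Master identity II (energy identity in differential form).** For `S` symmetric, `c`
conjugate symmetric and transversal on `S`, `g` conjugate symmetric, `u = realTrigPoly S c`,
`G = realTrigPoly S g`:
`∑_{k∈S} Re⟪c k, galerkinField ν S g c k⟫ = -ν ‖∇u‖²_{L²} + ∫ ⟪G, u⟫`, with
`‖∇u‖²_{L²} = (eGradNormSq u).toReal = 4π² ∑_{k∈S} |k|² ‖c k‖²`; the nonlinearity drops out
because `∑_{k∈S} Re⟪c k, 𝓕[(u·∇)u](k)⟫ = ∫ ⟪u, (u·∇)u⟫ = 0` for `div u = 0`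
(RRS 2016, (4.6)–(4.7); CF 1988, (8.7); Temam 1977, Ch. III (3.45)). [cite: RobinsonRodrigoSadowski2016, Thm. 4.4 Step 2 (4.6)–(4.7)] -/
theorem sum_re_inner_galerkinField_self (ν : ℝ) (hS : ∀ k ∈ S, -k ∈ S)
    {g c : (d → ℤ) → EuclideanSpace ℂ d} (hg : FunctionSpaces.Torus.IsConjSymm g) (hc : FunctionSpaces.Torus.IsConjSymm c)
    (hcT : FunctionSpaces.Torus.IsTransversal S c) :
    ∑ k ∈ S, (inner ℂ (c k) (galerkinField ν S g c k)).re =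
      -(ν * (FunctionSpaces.Torus.eGradNormSq (FunctionSpaces.Torus.realTrigPoly S c)).toReal) +
        ∫ x, ⟪FunctionSpaces.Torus.realTrigPoly S g x, FunctionSpaces.Torus.realTrigPoly S c x⟫_ℝ := by
  have hu : FunctionSpaces.Torus.IsSmooth (FunctionSpaces.Torus.realTrigPoly S c) := FunctionSpaces.Torus.isSmooth_realTrigPoly S c
  have hudiv : FunctionSpaces.Torus.IsDivFree (FunctionSpaces.Torus.realTrigPoly S c) := FunctionSpaces.Torus.isDivFree_realTrigPoly hcT
  have hsplit : ∀ k ∈ S, (inner ℂ (c k) (galerkinField ν S g c k)).re =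
      -(ν * (4 * Real.pi ^ 2 * (FunctionSpaces.Torus.freqNormSq k * ‖c k‖ ^ 2))) +
        ((inner ℂ (c k) (g k)).re - (inner ℂ (c k) (convectionCoeff S c c k)).re) := by
    intro k hk
    rw [galerkinField, inner_add_right, Complex.add_re, inner_leraySym_right_of_transversal _ _
      (hcT k hk), inner_sub_right, Complex.sub_re, inner_neg_right, Complex.neg_re,
      inner_smul_right, Complex.re_ofReal_mul]
    have hcc : (inner ℂ (c k) (c k)).re = ‖c k‖ ^ 2 := inner_self_eq_norm_sq (𝕜 := ℂ) (c k)
    rw [hcc]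
    ring
  rw [Finset.sum_congr rfl hsplit, Finset.sum_add_distrib, Finset.sum_sub_distrib,
    Finset.sum_neg_distrib, ← Finset.mul_sum, ← Finset.mul_sum, ← FunctionSpaces.Torus.toReal_eGradNormSq_realTrigPoly
    hS hc]
  have hforce : ∑ k ∈ S, (inner ℂ (c k) (g k)).re =
      ∫ x, ⟪FunctionSpaces.Torus.realTrigPoly S g x, FunctionSpaces.Torus.realTrigPoly S c x⟫_ℝ := by
    rw [← FunctionSpaces.Torus.integral_inner_realTrigPoly_realTrigPoly hS hc hg]
    exact integral_congr_ae (ae_of_all _ fun x => real_inner_comm _ _)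
  have hnl : ∑ k ∈ S, (inner ℂ (c k) (convectionCoeff S c c k)).re = 0 := by
    have h1 := FunctionSpaces.Torus.integral_inner_realTrigPoly_left hS hc ((hu.convect hu).memLp 2)
    simp_rw [mFourierCoeff_convect_realTrigPoly hS hc hc] at h1
    calc ∑ k ∈ S, (inner ℂ (c k) (convectionCoeff S c c k)).re
        = ∫ x, ⟪FunctionSpaces.Torus.realTrigPoly S c x, FunctionSpaces.Torus.convect (FunctionSpaces.Torus.realTrigPoly S c) (FunctionSpaces.Torus.realTrigPoly S c) x⟫_ℝ := h1.symm
      _ = ∫ x, ⟪FunctionSpaces.Torus.convect (FunctionSpaces.Torus.realTrigPoly S c) (FunctionSpaces.Torus.realTrigPoly S c) x, FunctionSpaces.Torus.realTrigPoly S c x⟫_ℝ :=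
          integral_congr_ae (ae_of_all _ fun x => real_inner_comm _ _)
      _ = 0 := FunctionSpaces.Torus.integral_inner_convect_self_eq_zero hu hudiv
  rw [hforce, hnl, sub_zero]

/-! ### Continuity of the Galerkin field in its arguments -/

omit [DecidableEq d] in
/-- The convection symbol depends continuously on finitely many coordinates of its two
arguments. [folklore] -/
theorem continuous_convectionCoeff {X : Type*} [TopologicalSpace X]
    {C C' : X → (d → ℤ) → EuclideanSpace ℂ d} (hC : ∀ l, Continuous fun x => C x l)
    (hC' : ∀ m, Continuous fun x => C' x m) (k : d → ℤ) :
    Continuous fun x => convectionCoeff S (C x) (C' x) k := by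
  unfold convectionCoeff
  refine continuous_finsetSum _ fun l _ => continuous_finsetSum _ fun m _ => ?_
  split_ifs
  · have hs : Continuous fun x => (2 * Real.pi * Complex.I * ∑ j, C x l j * (m j : ℂ)) :=
      continuous_const.mul (continuous_finsetSum _ fun j _ =>
        ((EuclideanSpace.proj j).continuous.comp (hC l)).mul continuous_const)
    exact hs.smul (hC' m)
  · exact continuous_const

omit [DecidableEq d] in
/-- The Galerkin field depends continuously on (finitely many coordinates of) the force
coefficients and the state. [folklore] -/
theorem continuous_galerkinField (ν : ℝ) {X : Type*} [TopologicalSpace X]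
    {G C : X → (d → ℤ) → EuclideanSpace ℂ d} (hG : ∀ k, Continuous fun x => G x k)
    (hC : ∀ k, Continuous fun x => C x k) (k : d → ℤ) :
    Continuous fun x => galerkinField ν S (G x) (C x) k := by
  unfold galerkinField
  have h1 : Continuous fun x => ((ν * (4 * Real.pi ^ 2 * FunctionSpaces.Torus.freqNormSq k) : ℝ) : ℂ) • C x k :=
    (hC k).const_smul (((ν * (4 * Real.pi ^ 2 * FunctionSpaces.Torus.freqNormSq k) : ℝ) : ℂ))
  exact h1.neg.add
    ((continuous_leraySym k).comp (((hG k).sub (continuous_convectionCoeff hC hC k))))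

end Field

end Torus

/-! ## The Galerkin phase space and the field on `S → ℂ^d` -/

section NS

open Torus FunctionSpaces.Torus

variable {d : Type*} [Fintype d]

section Coeff

variable {S : Finset (d → ℤ)}

variable (S) in
/-- **The Galerkin phase space**: the real subspace of `S → ℂ^d` of real (conjugate-symmetric)
divergence-free (transversal) coefficient vectors — the Fourier coordinates of the Galerkin
space `P_N H` (plus constants) of RRS 2016, §4.1 / CF 1988, (8.3). [cite: RobinsonRodrigoSadowski2016, §4.1 (4.1)] -/
def galerkinSubspace : Submodule ℝ (↥S → EuclideanSpace ℂ d) where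
  carrier := {c | IsRealCoeff c ∧ IsSolenoidalCoeff c}
  zero_mem' := ⟨fun k l _ => by simp, fun k => by simp⟩
  add_mem' := by
    rintro c c' ⟨hc, hcT⟩ ⟨hc', hc'T⟩
    refine ⟨hc.add hc', fun k => ?_⟩
    simp only [Pi.add_apply, PiLp.add_apply, mul_add, Finset.sum_add_distrib, hcT k, hc'T k,
      add_zero]
  smul_mem' := by
    rintro a c ⟨hc, hcT⟩
    refine ⟨hc.smul a, fun k => ?_⟩
    simp only [Pi.smul_apply, PiLp.smul_apply, Complex.real_smul, mul_left_comm _ (a : ℂ),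
      ← Finset.mul_sum, hcT k, mul_zero]

/-- Membership in the Galerkin phase space, unfolded. [folklore] -/
theorem mem_galerkinSubspace {c : ↥S → EuclideanSpace ℂ d} :
    c ∈ galerkinSubspace S ↔ IsRealCoeff c ∧ IsSolenoidalCoeff c := Iff.rfl

end Coeff

section Field

variable [DecidableEq d] {S : Finset (d → ℤ)}

variable (S) in
/-- The Galerkin vector field on coefficient vectors: `V(g, c)_k = galerkinField ν S ḡ c̄ k`,
`k ∈ S`, bars denoting extension by zero (RRS 2016, (4.5) in Fourier coordinates;
CF 1988, (8.5)). [cite: RobinsonRodrigoSadowski2016, Thm. 4.4 Step 1 (4.5)] -/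
def galerkinRHS (ν : ℝ) (g c : ↥S → EuclideanSpace ℂ d) : ↥S → EuclideanSpace ℂ d :=
  fun k => galerkinField ν S (coeffExt S g) (coeffExt S c) k

omit [DecidableEq d] in
/-- Unfolding of `galerkinRHS`. [folklore] -/
theorem galerkinRHS_apply (ν : ℝ) (g c : ↥S → EuclideanSpace ℂ d) (k : ↥S) :
    galerkinRHS S ν g c k = galerkinField ν S (coeffExt S g) (coeffExt S c) k := rfl

omit [DecidableEq d] in
/-- **Invariance**: for real force coefficients, the Galerkin field maps the Galerkin phase
space into itself (the flow stays real and divergence free). [folklore] -/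
theorem galerkinRHS_mem (ν : ℝ) (hS : ∀ k ∈ S, -k ∈ S) {g c : ↥S → EuclideanSpace ℂ d}
    (hg : IsRealCoeff g) (hc : c ∈ galerkinSubspace S) :
    galerkinRHS S ν g c ∈ galerkinSubspace S := by
  refine ⟨?_, ?_⟩
  · exact isRealCoeff_restrict
      ((hg.isConjSymm_coeffExt hS).galerkinField ν hS (hc.1.isConjSymm_coeffExt hS))
  · exact isSolenoidalCoeff_restrict
      (isTransversal_galerkinField ν (coeffExt S g) hc.2.isTransversal_coeffExt)

end Field

end NS

end Literature.Analysis.FluidPDE
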